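import Literature.Barriers.QuantumAdvantage.AaronsonChenAdvice
import Literature.Barriers.QuantumAdvantage.AaronsonChenMachine
import Literature.Computability.Complexity.PSpaceClosure
import Literature.Computability.Complexity.StringCopy
import Literature.Computability.Complexity.PairPlumbing
import HarnessLib

/-!
# Aaronson–Chen 2017, Lemma 5.3: the advice instance, its phase guards and sub-instances as `FP` bricks

First of three files proving that the ADVICE LANGUAGE `AcProto.advLang` of the `SampBPP^{TQBF,O}`
simulator of Aaronson–Chen 2017, Lemma 5.3 (`AaronsonChenProtocol.lean`; "all the computations can be
done in `PSPACE`", [AaronsonChen2017, §5.3 p. 23]) is in `PSPACE` once the two PHYSICAL predicates of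
`AaronsonChenAdvice.lean` are — `HeavyLang` (is the string `u` queried at stage `n`, given the history?)
and `CdfLang` (is `r/2^{|r|}` below the cumulative Born weight of the final state up to the label `Y`?).
The proof is class-level (the closure properties of `PSPACE` of `Complexity/PSpaceClosure.lean`,
`PSpaceGapThreshold.lean`: preimages under `FP` maps, bounded `∃`/`∀`, complement, majority/gap
thresholds, unions and intersections through a `PSPACE`-complete set) once the plumbing maps are
polynomial time, which is what this file provides, in the brick algebra
(`BrickAlgebra.lean`/`PlumbingBricks.lean`: `pairFn`, `fstP`/`sndP`, `polyFn`, `divModFn`, `dropFn`,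
`takeFn`, `onesFn`, `bitAtFn`, …):

* on the advice instance `z = ⟨w, h⟩`, `w = ⟨x₀, r⟩`: `repZ` (`⟨x₀, r⟩` re-paired, of length `wl`), `jU`
  (`1^{⌈|h|/2⌉}`, through `evensT`), `nremU`/`sbU` (the stage, slot and bit position of `j` by two
  unary divisions), the sub-instances `instL = ⟨w, ⟨h, ⟨1ⁿ, ⟨1ˢ, 1ᵇ⟩⟩⟩⟩`, `instS = ⟨w, ⟨h, 1^{j−L}⟩⟩`,
  `instO = ⟨w, ⟨h, 1^{j−L−W}⟩⟩`, with their values (`instL_apply`, …) and `FP` memberships;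
* the phase guards `GLearn` (`j < L`), `GBelowOut` (`j < L + W`) in `P` (`LenLt`);
* two small tools: `setOf_getD_mem_P` (the bit test `{z | (g z).getD |f z| = 1} ∈ P`) and `padFn`
  (the padded block `padBlock |W| u` as a brick, `padFn_apply`).

Sequel: `AaronsonChenAdviceLearn.lean` (the learning phase), `AaronsonChenAdvicePSPACE.lean`
(sampling/output phases, assembly, and Lemma 5.3 from the two predicates).

## References

* [AaronsonChen2017] arXiv:1612.05903, §5.3 (pp. 22–23), read via `lit read arxiv:1612.05903 --pages 19-25`.
* [AroraBarakCC2009] §4.1–4.2 (space-bounded closure properties), as used in `PSpaceClosure.lean`.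
-/

noncomputable section

namespace Literature.Barriers.QuantumAdvantage

open MeasureTheory _root_.Computability Polynomial Literature.Computability.Complexity
  Literature.Computability.Complexity.Brick Literature.Computability.Complexity.Plumb
  Literature.Computability.Complexity.OracleCompose Literature.Computability.Complexity.PRelSigma
  Literature.Computability.Complexity.TTClosure Literature.Computability.Complexity.StrEq
  Literature.Computability.Cryptography

/-! ### Unary numerals -/

/-- Mathlib's unary numeral is the all-ones string. [folklore] -/
theorem unaryEncodeNat_eq_ones : ∀ n : ℕ, unaryEncodeNat n = ones n
  | 0 => rfl
  | n + 1 => by rw [unaryEncodeNat, unaryEncodeNat_eq_ones n]; rfl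

/-- `onesFn w = 1^{|w|}`. [folklore] -/
@[simp] theorem onesFn_apply (w : List Bool) : onesFn w = ones w.length := unaryEncodeNat_eq_ones _

/-- `|1ⁿ| = n`. [folklore] -/
@[simp] theorem length_ones_eq (n : ℕ) : (ones n).length = n := List.length_replicate ..

namespace AcProto

variable (P : AcProto)

/-- The learning-phase length as a polynomial. [folklore] -/
def learnLenP : Polynomial ℕ := P.pF * (P.SmP * P.WdP)

/-- `learnLenP` evaluates to `learnLen`. [folklore] -/
@[simp] theorem eval_learnLenP (m : ℕ) : P.learnLenP.eval m = P.learnLen m := by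
  simp [learnLenP, learnLen, Gm]

/-- `SmP * WdP` evaluates to `Sm · Wd`. [folklore] -/
@[simp] theorem eval_SmP_mul_WdP (m : ℕ) : (P.SmP * P.WdP).eval m = P.Sm m * P.Wd m := by simp

/-! ### Accessors and instance maps on the advice instance `z = ⟨w, h⟩`, `w = ⟨x₀, r⟩` -/

/-- The game input and the coins re-paired: `⟨x₀, r⟩` (its length `wl x₀ r` sizes the schedule). [folklore] -/
def repZ : List Bool → List Bool := pairFn (fstP ∘ fstP) (sndP ∘ fstP)

/-- Value of `repZ`. [folklore] -/
theorem repZ_apply (z : List Bool) : repZ z = boolPair (fstP (fstP z)) (sndP (fstP z)) := by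
  simp [repZ, pairFn_apply]

/-- `repZ ∈ FP`. [folklore] -/
theorem repZ_mem_FP : repZ ∈ FP :=
  pairFn_mem_FP (comp_mem_FP fstP_mem_FP fstP_mem_FP) (comp_mem_FP sndP_mem_FP fstP_mem_FP)

/-- The length of the re-paired input is `wl`. [folklore] -/
theorem length_repZ (z : List Bool) : (repZ z).length = wl (fstP (fstP z)) (sndP (fstP z)) := by
  rw [repZ_apply]; rfl

/-- The unary numeral `1^{⌈|h|/2⌉}` of the advice index (`= |h|/2` for even `|h|`). [folklore] -/
def jU : List Bool → List Bool := onesFn ∘ evensT.eval ∘ sndP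

/-- Value of `jU`. [folklore] -/
theorem jU_apply (z : List Bool) : jU z = ones (((sndP z).length + 1) / 2) := by
  simp [jU, evensT_eval]

/-- `jU ∈ FP`. [folklore] -/
theorem jU_mem_FP : jU ∈ FP :=
  comp_mem_FP onesFn_mem_FP (comp_mem_FP evensT.polyTimeComputable_eval sndP_mem_FP)

/-- `⟨1^{j / (SW)}, 1^{j mod (SW)}⟩`. [folklore] -/
def nremU : List Bool → List Bool := divModFn ∘ pairFn (polyFn (P.SmP * P.WdP) ∘ repZ) jU

/-- `⟨1^s, 1^b⟩ = ⟨1^{(j mod SW) / W}, 1^{(j mod SW) mod W}⟩`. [folklore] -/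
def sbU : List Bool → List Bool := divModFn ∘ pairFn (polyFn P.WdP ∘ repZ) (sndP ∘ P.nremU)

/-- The advice index in unary read off `z`. [folklore] -/
def jOf (z : List Bool) : ℕ := ((sndP z).length + 1) / 2

/-- The schedule length read off `z`. [folklore] -/
def mmOf (z : List Bool) : ℕ := wl (fstP (fstP z)) (sndP (fstP z))

/-- Value of `nremU`. [folklore] -/
theorem nremU_apply (z : List Bool) :
    P.nremU z = boolPair (ones (jOf z / (P.Sm (mmOf z) * P.Wd (mmOf z))))
      (ones (jOf z % (P.Sm (mmOf z) * P.Wd (mmOf z)))) := by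
  simp [nremU, jU_apply, length_repZ, jOf, mmOf]

/-- Value of `sbU`. [folklore] -/
theorem sbU_apply (z : List Bool) :
    P.sbU z = boolPair (ones (jOf z % (P.Sm (mmOf z) * P.Wd (mmOf z)) / P.Wd (mmOf z)))
      (ones (jOf z % (P.Sm (mmOf z) * P.Wd (mmOf z)) % P.Wd (mmOf z))) := by
  simp [sbU, nremU_apply, length_repZ, mmOf]

/-- `nremU ∈ FP`. [folklore] -/
theorem nremU_mem_FP : P.nremU ∈ FP :=
  comp_mem_FP divModFn_mem_FP (pairFn_mem_FP (comp_mem_FP (polyFn_mem_FP _) repZ_mem_FP) jU_mem_FP)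

/-- `sbU ∈ FP`. [folklore] -/
theorem sbU_mem_FP : P.sbU ∈ FP :=
  comp_mem_FP divModFn_mem_FP (pairFn_mem_FP (comp_mem_FP (polyFn_mem_FP _) repZ_mem_FP)
    (comp_mem_FP sndP_mem_FP P.nremU_mem_FP))

/-- **The learning-phase instance** `⟨w, ⟨h, ⟨1ⁿ, ⟨1ˢ, 1ᵇ⟩⟩⟩⟩`. [folklore] -/
def instL : List Bool → List Bool := pairFn fstP (pairFn sndP (pairFn (fstP ∘ P.nremU) P.sbU))

/-- Value of `instL`. [folklore] -/
theorem instL_apply (z : List Bool) :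
    P.instL z = boolPair (fstP z) (boolPair (sndP z) (boolPair (ones (jOf z / (P.Sm (mmOf z) * P.Wd (mmOf z))))
      (boolPair (ones (jOf z % (P.Sm (mmOf z) * P.Wd (mmOf z)) / P.Wd (mmOf z)))
        (ones (jOf z % (P.Sm (mmOf z) * P.Wd (mmOf z)) % P.Wd (mmOf z)))))) := by
  simp [instL, nremU_apply, sbU_apply]

/-- `instL ∈ FP`. [folklore] -/
theorem instL_mem_FP : P.instL ∈ FP :=
  pairFn_mem_FP fstP_mem_FP (pairFn_mem_FP sndP_mem_FP (pairFn_mem_FP (comp_mem_FP fstP_mem_FP P.nremU_mem_FP)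
    P.sbU_mem_FP))

/-- `1^{j − L}`. [folklore] -/
def tSU : List Bool → List Bool := dropFn ∘ pairFn (polyFn P.learnLenP ∘ repZ) jU

/-- `1^{j − L − W}`. [folklore] -/
def tOU : List Bool → List Bool := dropFn ∘ pairFn (polyFn P.WdP ∘ repZ) P.tSU

/-- Value of `tSU`. [folklore] -/
theorem tSU_apply (z : List Bool) : P.tSU z = ones (jOf z - P.learnLen (mmOf z)) := by
  simp [tSU, jU_apply, length_repZ, jOf, mmOf, ones, List.drop_replicate]

/-- Value of `tOU`. [folklore] -/
theorem tOU_apply (z : List Bool) : P.tOU z = ones (jOf z - P.learnLen (mmOf z) - P.Wd (mmOf z)) := by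
  simp [tOU, tSU_apply, length_repZ, mmOf, ones, List.drop_replicate]

/-- `tSU ∈ FP`. [folklore] -/
theorem tSU_mem_FP : P.tSU ∈ FP :=
  comp_mem_FP dropFn_mem_FP (pairFn_mem_FP (comp_mem_FP (polyFn_mem_FP _) repZ_mem_FP) jU_mem_FP)

/-- `tOU ∈ FP`. [folklore] -/
theorem tOU_mem_FP : P.tOU ∈ FP :=
  comp_mem_FP dropFn_mem_FP (pairFn_mem_FP (comp_mem_FP (polyFn_mem_FP _) repZ_mem_FP) P.tSU_mem_FP)

/-- **The sampling-phase instance** `⟨w, ⟨h, 1^{j−L}⟩⟩`. [folklore] -/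
def instS : List Bool → List Bool := pairFn fstP (pairFn sndP P.tSU)

/-- **The output-phase instance** `⟨w, ⟨h, 1^{j−L−W}⟩⟩`. [folklore] -/
def instO : List Bool → List Bool := pairFn fstP (pairFn sndP P.tOU)

/-- Value of `instS`. [folklore] -/
theorem instS_apply (z : List Bool) :
    P.instS z = boolPair (fstP z) (boolPair (sndP z) (ones (jOf z - P.learnLen (mmOf z)))) := by
  simp [instS, tSU_apply]

/-- Value of `instO`. [folklore] -/
theorem instO_apply (z : List Bool) :
    P.instO z = boolPair (fstP z) (boolPair (sndP z) (ones (jOf z - P.learnLen (mmOf z) - P.Wd (mmOf z)))) := by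
  simp [instO, tOU_apply]

/-- `instS ∈ FP`. [folklore] -/
theorem instS_mem_FP : P.instS ∈ FP := pairFn_mem_FP fstP_mem_FP (pairFn_mem_FP sndP_mem_FP P.tSU_mem_FP)

/-- `instO ∈ FP`. [folklore] -/
theorem instO_mem_FP : P.instO ∈ FP := pairFn_mem_FP fstP_mem_FP (pairFn_mem_FP sndP_mem_FP P.tOU_mem_FP)

/-! ### The phase guards (in `P`) -/

/-- The learning-phase guard `⌈|h|/2⌉ < L(wl)`. [folklore] -/
def GLearn : Language Bool := pairFn repZ jU ⁻¹' LenLt P.learnLenP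

/-- The guard `⌈|h|/2⌉ < L(wl) + W(wl)`. [folklore] -/
def GBelowOut : Language Bool := pairFn repZ jU ⁻¹' LenLt (P.learnLenP + P.WdP)

/-- Membership in `GLearn`. [folklore] -/
theorem mem_GLearn_iff (z : List Bool) : z ∈ P.GLearn ↔ jOf z < P.learnLen (mmOf z) := by
  unfold GLearn
  rw [memL_preimage, pairFn_apply, boolPair_mem_LenLt, length_repZ, jU_apply, length_ones_eq, eval_learnLenP]
  rfl

/-- Membership in `GBelowOut`. [folklore] -/
theorem mem_GBelowOut_iff (z : List Bool) : z ∈ P.GBelowOut ↔ jOf z < P.learnLen (mmOf z) + P.Wd (mmOf z) := by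
  unfold GBelowOut
  rw [memL_preimage, pairFn_apply, boolPair_mem_LenLt, length_repZ, jU_apply, length_ones_eq, eval_add,
    eval_learnLenP, eval_WdP]
  rfl

/-- `GLearn ∈ P`. [folklore] -/
theorem GLearn_mem_P : P.GLearn ∈ Classes.P :=
  preimage_mem_P (LenLt_mem_P _) (pairFn_mem_FP repZ_mem_FP jU_mem_FP)

/-- `GBelowOut ∈ P`. [folklore] -/
theorem GBelowOut_mem_P : P.GBelowOut ∈ Classes.P :=
  preimage_mem_P (LenLt_mem_P _) (pairFn_mem_FP repZ_mem_FP jU_mem_FP)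

/-! ### Small tools: one-bit tests as `P` languages -/

/-- Reading one bit: `(l ⇂ i) ↾ 1 = [1]` iff bit `i` of `l` is set. [folklore] -/
theorem take_one_drop_eq_iff (l : List Bool) (i : ℕ) : (l.drop i).take 1 = [true] ↔ l.getD i false = true := by
  rw [List.getD_eq_getElem?_getD]
  cases h : l[i]? with
  | none =>
    rw [List.getElem?_eq_none_iff] at h
    simp [List.drop_of_length_le h]
  | some b =>
    obtain ⟨hi, rfl⟩ := List.getElem?_eq_some_iff.1 h
    rw [List.take_one_drop_eq_of_lt_length hi]
    simp

/-- **The bit test** `z ↦ [bit |f z| of g z]` decides `{z | (g z).getD |f z| = 1}` in `P`, for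
`f, g ∈ FP`. [folklore] -/
theorem setOf_getD_mem_P {f g : List Bool → List Bool} (hf : f ∈ FP) (hg : g ∈ FP) :
    {z | (g z).getD (f z).length false = true} ∈ Classes.P := by
  refine mem_P_of_mem_FP (comp_mem_FP eqPairFn_mem_FP (pairFn_mem_FP (comp_mem_FP bitAtFn_mem_FP (pairFn_mem_FP hf hg))
    (const_mem_FP [true]))) _ fun z => ?_
  simp only [Function.comp_apply, pairFn_apply, bitAtFn_boolPair, eqPairFn_boolPair]
  have e : ((g z).drop (f z).length).take 1 = [true] ↔ (g z).getD (f z).length false = true :=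
    take_one_drop_eq_iff _ _
  constructor
  · intro h
    have h' : (g z).getD (f z).length false = true := h
    rw [← e] at h'
    simp [h']
  · intro h
    have h' : ¬ (g z).getD (f z).length false = true := h
    rw [← e] at h'
    simp [h']

/-- **The padded block as a brick**: `z ↦ padBlock |Wf z| (uf z)` is
`takeFn ⟨Wf, concatFn ⟨zerosFn (dropFn ⟨1·uf, Wf⟩), 1·uf⟩⟩`. [folklore] -/
def padFn (Wf uf : List Bool → List Bool) : List Bool → List Bool :=
  takeFn ∘ pairFn Wf (concatFn ∘ pairFn (Kannan.zerosFn ∘ dropFn ∘ pairFn (List.cons true ∘ uf) Wf) (List.cons true ∘ uf))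

/-- Value of `padFn`. [folklore] -/
theorem padFn_apply (Wf uf : List Bool → List Bool) (z : List Bool) :
    padFn Wf uf z = padBlock (Wf z).length (uf z) := by
  simp only [padFn, Function.comp_apply, pairFn_apply, takeFn_boolPair, concatFn_boolPair, Kannan.zerosFn_apply,
    dropFn_boolPair, List.length_cons, List.length_drop, padBlock]
  congr 3
  omega

/-- `padFn Wf uf ∈ FP` for `Wf, uf ∈ FP`. [folklore] -/
theorem padFn_mem_FP {Wf uf : List Bool → List Bool} (hW : Wf ∈ FP) (hu : uf ∈ FP) : padFn Wf uf ∈ FP :=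
  comp_mem_FP takeFn_mem_FP (pairFn_mem_FP hW (comp_mem_FP concatFn_mem_FP (pairFn_mem_FP
    (comp_mem_FP Kannan.zerosFn_mem_FP (comp_mem_FP dropFn_mem_FP (pairFn_mem_FP (comp_mem_FP (cons_mem_FP true) hu) hW)))
    (comp_mem_FP (cons_mem_FP true) hu))))

end AcProto

end Literature.Barriers.QuantumAdvantage

end
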